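/-
Copyright: the b2b-balaban cell (near-miss cell 7), T⁴-continuum fan-out, lineage t4-ne7b-p1 (node U5c COUNT member).
Released under the licence of the surrounding project.
-/
import Summits.QuantumFields.BalabanUV.T4Continuum.Support.PlacementBatchCredits
import Literature.MathematicalPhysics.QuantumFieldTheory.Balaban1983to89.T4PartnerMultiplicity

/-!
# The count member's chain with a FACTORIAL-CARRYING multiplicity binder (`hlabF`)

Summits-side support leaf of the T⁴-continuum cell (rung (B)+1 on a FINITE torus only; NOT infinite volume, NOT the
mass gap, NOT the Clay statement; NOT a proof of the spine estimate NE7b).  Lineage `t4-ne7b-p1`, node U5c, wall (GM),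
located item G-ne7bp1g18-2 — the binder owner's half: the RE-TYPED multiplicity binder.  [folklore] bookkeeping over the
lineage's OWN typed carrier; nothing is quoted from print and nothing printed is asserted.

WHAT.  `T4PartnerMultiplicity.exists_irThreshold_relWeightBoundM` (tree) is the count member's chain as ONE statement;
its labelling binder `hlabM` asks the price of a live slot to be at most `Λ′^{partnerAges G}·e^{−credits}·e^{+lifeCost}`
of some consistent genealogy `G` with that record.  The placement assembly (`Support/PlacementSkeleton`,
`Support/PlacementExponent`) delivers multiplicities per record that carry, besides `Λ′^{partnerAges}`, the per-step
BATCH FACTORIALS `∏_t n_t(G)!` of the genealogy's births (located item G-ne7bp1g18-2: same-step batches are genuinely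
factorial).  This file states the chain with the HONEST binder

  `hlabF`:  `y ≤ 0 ∨ ∃ G, Consistent ∧ WF ∧ rootStep = j ∧ K < reach ∧ root = b ∧ events ∖ root = Q ∧`
            `y ≤ (∏_{t ≤ K} n_t(G)!) · Λ′^{partnerAges G} · e^{−credits (credit C g_K) G} · e^{+lifeCost G}`

and proves it from the landed theorem VERBATIM, run at the LOWERED quadratic birth constant
`lowerA C (rate θ)`, `rate θ = θ + log (1 + 2/θ)` (`Support/PlacementBatchCredits`: the factorials cost `θ·Σ(d′+1)`
and a constant `1 + 2/θ` per birth, and the constant per birth is paid by `a` as well).  Every other constant, budget,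
rate and conclusion is LITERALLY the landed one: `rho`, `eta`, `cost`, `lifeCost`, `dictW`, `Consistent`, `κ₁` do not
see `a` (`consistent_lowerA_iff`, `rho_lowerA`, `eta_lowerA`; the rest by definitional unfolding).

DISPLAYED BINDERS that differ from the landed statement (nothing hidden): `1 ≤ C.A₀` (was `0 < C.A₀`) — with the run
regime `1 ≤ log (g_{K,s}²)⁻¹` it gives the profile floor `1 ≤ p₀(g_{K,s})` at every performed step
(`one_le_p0Profile`; events of a consistent genealogy are performed steps, `step_le_of_consistent`); and
`rate θ < C.a` for some `θ > 0` (was `0 < C.a`).  Whether the cell's `a` (print's `½γ₀A₁²` of (1.79), CONTEXT only)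
has this room is an (E2)-side constant, not decided here.

WHAT THIS FILE DOES NOT DO.  It does not inhabit `hlabF` (that is the (GM) assembly instantiated behind the reading (ID),
residual (r1), plus the zone-target re-assembly, GAPS G-ne7bp1g18-2 (I)); it does not touch the Literature module
`T4PartnerMultiplicity` (the landed `hlabM` chain stays as it is; this is a NEW statement beside it).

HONEST DEPENDENCY (cell): continuum YM on T⁴ ⇐ BetaPertH ∧ nine spine estimates (0/9 proved); BetaPertH ⇐ (D1) ∧ (D4)
∧ CAP+tail.  This file changes none of it.
-/

open Finset
open scoped Nat
open Literature.MathematicalPhysics.QuantumFieldTheory.Balaban1983to89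
open T4PersistenceDictionary T4PersistentHistoryCount T4BankedInduction T4PrintedShapeBanking
open T4WeightBudget T4GlobalDenominator T4LiveClassFibration T4LiveStructureGas T4LiveGasToTerms T4RecordPriceSeam
open T4PartnerMultiplicity
open Summit.QuantumFields.BalabanUV.T4Continuum.PlacementBatch

namespace Summit.QuantumFields.BalabanUV.T4Continuum.PartnerMultiplicityF

noncomputable section

/-! ## §1 Events of a consistent genealogy are performed steps -/

/-- **EVERY EVENT OF A CONSISTENT GENEALOGY HAPPENS AT A STEP `≤ K`**: births `j ≤ K`, renewals `h + 1 ≤ K`, mergers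
`step ≤ K` are clauses of `Consistent`; hereditary. [folklore] -/
theorem step_le_of_consistent {C : T4PrintedShapeBanking.Consts} {K : ℕ} {R : ℕ → ℕ} :
    ∀ {G : Gen PEv}, Consistent C K R G → ∀ e ∈ G.events, e.step ≤ K
  | Gen.born b j, hc, e, he => by
      simp only [Consistent] at hc
      obtain ⟨-, hs, hj⟩ := hc
      simp only [Gen.events_born, Finset.mem_singleton] at he
      subst he
      omega
  | Gen.renew G e h, hc, e', he' => by
      simp only [Consistent] at hc
      obtain ⟨hG, -, hs, -, hK⟩ := hc
      simp only [Gen.events_renew, Finset.mem_insert] at he'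
      rcases he' with rfl | he'
      · omega
      · exact step_le_of_consistent hG e' he'
  | Gen.merge X Y e, hc, e', he' => by
      simp only [Consistent] at hc
      obtain ⟨hX, hY, -, -, -, -, -, hK⟩ := hc
      simp only [Gen.events_merge, Finset.mem_insert, Finset.mem_union] at he'
      rcases he' with rfl | he' | he'
      · exact hK
      · exact step_le_of_consistent hX e' he'
      · exact step_le_of_consistent hY e' he'

/-- **THE PROFILE FLOOR FROM THE RUN REGIME**: `1 ≤ A₀` and `1 ≤ log (x²)⁻¹` give `1 ≤ p₀(x) = A₀·(log (x²)⁻¹)^{p₀}`.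
[folklore] -/
theorem one_le_p0Profile {A₀ : ℝ} (hA : 1 ≤ A₀) (p₀ : ℕ) {x : ℝ} (hx : 1 ≤ Real.log (x ^ 2)⁻¹) :
    1 ≤ p0Profile A₀ p₀ x := by
  unfold p0Profile
  have h1 : (1 : ℝ) ≤ (Real.log (x ^ 2)⁻¹) ^ p₀ := one_le_pow₀ hx
  nlinarith

/-! ## §2 What does not see `a` -/

/-- `Consistent` reads only `n₁` of the constants: consistency at `lowerA C θ` is consistency at `C`. [folklore] -/
theorem consistent_lowerA_iff (C : T4PrintedShapeBanking.Consts) (θ : ℝ) (K : ℕ) (R : ℕ → ℕ) :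
    ∀ G : Gen PEv, Consistent (lowerA C θ) K R G ↔ Consistent C K R G
  | Gen.born b j => Iff.rfl
  | Gen.renew G e h => by
      simp only [Consistent, consistent_lowerA_iff C θ K R G, lowerA_n₁]
  | Gen.merge X Y e => by
      simp only [Consistent, consistent_lowerA_iff C θ K R X, consistent_lowerA_iff C θ K R Y, lowerA_n₁]

/-- the birth residual `ρ` does not see `a` [folklore] -/
theorem rho_lowerA (C : T4PrintedShapeBanking.Consts) (θ : ℝ) (g : ℕ → ℝ) : rho (lowerA C θ) g = rho C g := rfl

/-- the event weight `η` does not see `a` [folklore] -/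
theorem eta_lowerA (C : T4PrintedShapeBanking.Consts) (θ : ℝ) : eta (lowerA C θ) = eta C := rfl

/-- lowering twice is lowering by the sum [folklore] -/
theorem lowerA_lowerA (C : T4PrintedShapeBanking.Consts) (θ₁ θ₂ : ℝ) :
    lowerA (lowerA C θ₁) θ₂ = lowerA C (θ₁ + θ₂) := by
  cases C
  simp [lowerA, sub_sub]

/-! ## §3 The total rate: the constant per birth is paid by `a` as well -/

/-- **THE TOTAL LOWERING OF `a`** that pays the batch factorials: `rate θ = θ + log (1 + 2/θ)` — `θ·Σ(d′+1)` for the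
factorials proper (`PlacementBatch`) and `log (1 + 2/θ)` per birth for the constant. [folklore] -/
def rate (θ : ℝ) : ℝ := θ + Real.log (1 + 2 / θ)

/-- `1 < 1 + 2/θ` for `θ > 0` [folklore] -/
theorem one_lt_one_add_two_div {θ : ℝ} (hθ : 0 < θ) : (1 : ℝ) < 1 + 2 / θ := by
  have := div_pos (two_pos : (0 : ℝ) < 2) hθ
  linarith

/-- `θ < rate θ` for `θ > 0` (the logarithm is positive) [folklore] -/
theorem lt_rate {θ : ℝ} (hθ : 0 < θ) : θ < rate θ := by
  have := Real.log_pos (one_lt_one_add_two_div hθ)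
  unfold rate
  linarith

/-- **A CONSTANT `e^{θ}` PER BIRTH IS PAID BY LOWERING `a` BY `θ`**: with the profile floor at the birth steps,
`(e^{θ})^{#births G} · e^{−credits (credit C g) G} ≤ e^{−credits (credit (lowerA C θ) g) G}` (each birth yields
`θ·(d′+1) ≥ θ`). [folklore] -/
theorem pow_mul_exp_neg_credits_le {C : T4PrintedShapeBanking.Consts} {g : ℕ → ℝ} {θ : ℝ} (hθ : 0 ≤ θ) (G : Gen PEv)
    (hP : ∀ e ∈ G.events, e.kind = 0 → 1 ≤ p0Profile C.A₀ C.p₀ (g e.step)) :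
    Real.exp θ ^ (G.events.filter fun e => e.kind = 0).card * Real.exp (-credits (credit C g) G) ≤
      Real.exp (-credits (credit (lowerA C θ) g) G) := by
  set B := G.events.filter (fun e => e.kind = 0)
  have h := credits_lowerA_add_le hθ G hP
  have hs : (B.card : ℝ) ≤ ∑ e ∈ B, ((e.fat : ℝ) + 1) := by
    have : ∑ e ∈ B, (1 : ℝ) ≤ ∑ e ∈ B, ((e.fat : ℝ) + 1) :=
      sum_le_sum fun e _ => le_add_of_nonneg_left (Nat.cast_nonneg _)
    simpa using this
  have hB : credits (credit (lowerA C θ) g) G + θ * B.card ≤ credits (credit C g) G := by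
    have := mul_le_mul_of_nonneg_left hs hθ
    linarith
  rw [← Real.exp_nat_mul, ← Real.exp_add]
  exact Real.exp_le_exp.2 (by nlinarith)

/-- **THE BATCH FACTORIALS ARE PAID BY LOWERING `a` BY `rate θ`**: for `θ > 0`, births' steps in `T`, the profile floor
at the birth steps — `(∏_{t∈T} n_t(G)!) · e^{−credits (credit C g) G} ≤ e^{−credits (credit (lowerA C (rate θ)) g) G}`.
`PlacementBatch.prod_factorial_mul_exp_neg_credits_le` at `θ`, then `pow_mul_exp_neg_credits_le` at `log (1 + 2/θ)` on
`lowerA C θ`. [folklore] -/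
theorem prod_factorial_mul_exp_neg_credits_le_rate {θ : ℝ} (hθ : 0 < θ) (C : T4PrintedShapeBanking.Consts)
    (g : ℕ → ℝ) (G : Gen PEv) (T : Finset ℕ) (hT : ∀ e ∈ G.events, e.kind = 0 → e.step ∈ T)
    (hP : ∀ e ∈ G.events, e.kind = 0 → 1 ≤ p0Profile C.A₀ C.p₀ (g e.step)) :
    (∏ t ∈ T, (((birthsAt G.events t).card)! : ℝ)) * Real.exp (-credits (credit C g) G) ≤
      Real.exp (-credits (credit (lowerA C (rate θ)) g) G) := by
  have h1 := prod_factorial_mul_exp_neg_credits_le hθ C g G T hT hP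
  have h12 := one_lt_one_add_two_div hθ
  have hθ₂ : 0 ≤ Real.log (1 + 2 / θ) := (Real.log_pos h12).le
  have h2 := pow_mul_exp_neg_credits_le (C := lowerA C θ) (g := g) hθ₂ G hP
  rw [Real.exp_log (by linarith), lowerA_lowerA] at h2
  exact h1.trans h2

/-! ## §4 End to end with the factorial-carrying binder -/

section EndToEnd

variable {γ κ ι : Type*} [DecidableEq γ] [DecidableEq κ] {l₀ : ℝ} {K₀ : ℕ} {π : ℕ → ι → κ} {T : ℕ → Finset ι}
  {A A' : ℕ → ℝ → ι → ℝ} {Bad' : ℕ → ℝ → Finset κ} {dead dead' : ℕ → ℝ → ι → ℝ} {F Rf F' Rf' : ℕ → κ → ℝ}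
  {nlow nup mlow mup : ℕ → ℝ → ℝ} {Cn : ℝ}

/-- **END TO END WITH FACTORIAL-CARRYING MULTIPLICITY — ONE INFRARED THRESHOLD, THEN THE WEIGHT SLOT.**
`T4PartnerMultiplicity.exists_irThreshold_relWeightBoundM` VERBATIM except: (i) the labelling binder is `hlabF` — the
price of a live slot `(j, z, b, Q)` of cutoff `K` is `≤ 0` or at most
`(∏_{t ≤ K} n_t(G)!) · Λ′^{partnerAges G} · e^{−credits (credit C g_K) G} · e^{+lifeCost G}` for SOME consistent
well-formed genealogy `G` born at `j`, pending at `K`, with root `b` and record `Q`, where `n_t(G)` is the number of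
births of `G` at step `t` (`PlacementBatch.birthsAt`); (ii) `1 ≤ C.A₀` replaces `0 < C.A₀`; (iii) `0 < θ` and
`rate θ < C.a` replace `0 < C.a`.  SAME threshold shape, SAME budgets `ρ̄`, `η̄`, SAME rate `Λ·e^{η̄ − κ₁} < 1`, SAME
`Λ′`-conditions, SAME conclusion `∃ K₁ ≥ K₀, RelWeightBound … (𝟙_{K ≥ K₁}·Cn·recordsBudget ρ̄ κ₁ V Λ η̄ j⋆)`.
Proof: the landed theorem at the constants `lowerA C (rate θ)`; `hlabF ⇒ hlabM` there by
`prod_factorial_mul_exp_neg_credits_le_rate` with the profile floor from (ii) and the run regime. [folklore] -/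
theorem exists_irThreshold_relWeightBoundF (C : T4PrintedShapeBanking.Consts) (hC : C.Valid) {θ : ℝ} (hθ : 0 < θ)
    (ha : rate θ < C.a) (hA₀ : 1 ≤ C.A₀) {L r : ℕ} (hL : 1 ≤ L) {β₀ : ℝ} (hβ : 0 ≤ β₀) (hrq : r * (C.q' + 1) < C.p₀)
    (Cell : ℕ → ℕ → Finset γ) {V Λ : ℝ} (hV : 0 ≤ V) (hΛ : 0 < Λ)
    (hcell : ∀ K a, ((Cell K a).card : ℝ) ≤ V * Λ ^ a) (E B : ℕ → ℕ → Finset PEv)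
    (hE : ∀ K j, ∀ e ∈ E K j, PEv.step e ∈ Ioc j K) (jstar : ℕ → ℕ) (hj : ∀ K, jstar K ≤ K) {c : ℝ} (hc : 0 < c)
    (hfrac : ∀ K : ℕ, c * K ≤ ((K - jstar K : ℕ) : ℝ))
    (hA : Regeneration l₀ π T A Bad' dead F Rf nlow nup Cn K₀)
    (hA' : Regeneration l₀ π T A' Bad' dead' F' Rf' mlow mup Cn K₀) (hCn : 0 ≤ Cn) :
    ∃ x₀ : ℝ, ∀ (R : ℕ → ℕ → ℕ) (g : ℕ → ℕ → ℝ) (β' : ℕ → ℝ),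
      (∀ K, K₀ ≤ K → B14.FlowIneq27 (g K) (β' K) β₀ C.p₀ K) →
      (∀ K, K₀ ≤ K → B14FlowStep.FlowIneq29 (R K) (g K) L (β' K) β₀ K) →
      (∀ K, K₀ ≤ K → ∀ s, s ≤ K → B14.IsRj L r (g K s) (R K s)) →
      (∀ K, K₀ ≤ K → ∀ s, s ≤ K → 1 ≤ Real.log ((g K s) ^ 2)⁻¹) →
      (∀ K, K₀ ≤ K → x₀ ≤ Real.log ((g K K) ^ 2)⁻¹) →
      ∀ {ρbar ηbar : ℝ}, (∀ K j, ∑ b ∈ B K j, rho C (g K) b ≤ ρbar) →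
      (∀ K j, ∀ t ∈ Ioc j K, ∑ e ∈ E K j with PEv.step e = t, eta C e ≤ ηbar) →
      Λ * Real.exp (ηbar - C.κ₁) < 1 →
      ∀ {Λ' : ℝ}, 0 ≤ Λ' → Λ' * Real.exp (-C.κ₁) ≤ 1 →
      ∀ (y : ℕ → ℕ → γ → PEv → Finset PEv → ℝ),
      (∀ K, ∀ j ≤ K, ∀ z ∈ Cell K (K - j), ∀ b ∈ B K j,
        ∀ Q ∈ records (dictW (R K) C.n₁) j K (E K j) b, 0 ≤ y K j z b Q) →
      (∀ K, K₀ ≤ K → ∀ j ≤ K, ∀ z ∈ Cell K (K - j), ∀ b ∈ B K j,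
        ∀ Q ∈ records (dictW (R K) C.n₁) j K (E K j) b,
        y K j z b Q ≤ 0 ∨ ∃ G : Gen PEv, Consistent C K (R K) G ∧ G.WF (dictW (R K) C.n₁) ∧ G.rootStep = j ∧
          K < G.reach (dictW (R K) C.n₁) ∧ G.root = b ∧ G.events.erase G.root = Q ∧
          y K j z b Q ≤ (∏ t ∈ Finset.range (K + 1), (((birthsAt G.events t).card)! : ℝ)) *
            (Λ' ^ partnerAges PEv.step G * (Real.exp (-credits (credit C (g K)) G) *
              Real.exp (lifeCost (dictW (R K) C.n₁) (cost C K (R K)) G)))) →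
      ∀ (str : ℕ → κ → Finset (Slot γ PEv)),
      (∀ K t, |t| ≤ l₀ → K₀ ≤ K → Set.InjOn (str K) (Bad' K t)) →
      (∀ K t, |t| ≤ l₀ → K₀ ≤ K → ∀ c ∈ Bad' K t,
        str K c ⊆ liveSlots Cell (dictW (R K) C.n₁) E B K ∧
          ∃ o ∈ oldSlots Cell (dictW (R K) C.n₁) E B jstar K, o ∈ str K c) →
      (∀ K t, |t| ≤ l₀ → K₀ ≤ K → ∀ c ∈ Bad' K t, F K c * Rf K c ≤ famWeight (slotPrice (y K)) (str K c)) →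
      (∀ K t, |t| ≤ l₀ → K₀ ≤ K → ∀ c ∈ Bad' K t, F' K c * Rf' K c ≤ famWeight (slotPrice (y K)) (str K c)) →
      ∃ K₁, K₀ ≤ K₁ ∧ RelWeightBound l₀ T A A' (fun K t => if K₁ ≤ K then badOfClass π T Bad' K t else ∅)
        (Set.indicator {K | K₁ ≤ K} (fun K => Cn * recordsBudget ρbar C.κ₁ V Λ ηbar jstar K)) := by
  have hC' : (lowerA C (rate θ)).Valid := lowerA_valid hC _
  have ha' : 0 < (lowerA C (rate θ)).a := by rw [lowerA_a]; linarith
  have hA₀' : 0 < (lowerA C (rate θ)).A₀ := by rw [lowerA_A₀]; linarith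
  obtain ⟨x₀, hx₀⟩ := exists_irThreshold_relWeightBoundM (lowerA C (rate θ)) hC' ha' hA₀' hL hβ hrq Cell hV hΛ
    hcell E B hE jstar hj hc hfrac hA hA' hCn
  refine ⟨x₀, ?_⟩
  intro R g β' h27 h29 hR hx1 hir ρbar ηbar hρbar hηbar hr Λ' hΛ0 hΛ1 y hy0 hlabF str hinj hstr hF hF'
  have hlabM : ∀ K, K₀ ≤ K → ∀ j ≤ K, ∀ z ∈ Cell K (K - j), ∀ b ∈ B K j,
      ∀ Q ∈ records (dictW (R K) C.n₁) j K (E K j) b,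
      y K j z b Q ≤ 0 ∨ ∃ G : Gen PEv, Consistent (lowerA C (rate θ)) K (R K) G ∧ G.WF (dictW (R K) C.n₁) ∧
        G.rootStep = j ∧ K < G.reach (dictW (R K) C.n₁) ∧ G.root = b ∧ G.events.erase G.root = Q ∧
        y K j z b Q ≤ Λ' ^ partnerAges PEv.step G * (Real.exp (-credits (credit (lowerA C (rate θ)) (g K)) G) *
          Real.exp (lifeCost (dictW (R K) C.n₁) (cost C K (R K)) G)) := by
    intro K hK j hj z hz b hb Q hQ
    rcases hlabF K hK j hj z hz b hb Q hQ with h0 | ⟨G, hcG, hW, hrs, hKr, hroot, hQ', hy⟩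
    · exact Or.inl h0
    · refine Or.inr ⟨G, (consistent_lowerA_iff C (rate θ) K (R K) G).2 hcG, hW, hrs, hKr, hroot, hQ', hy.trans ?_⟩
      have hP : ∀ e ∈ G.events, e.kind = 0 → 1 ≤ p0Profile C.A₀ C.p₀ (g K e.step) := fun e he _ =>
        one_le_p0Profile hA₀ C.p₀ (hx1 K hK e.step (step_le_of_consistent hcG e he))
      have hT : ∀ e ∈ G.events, e.kind = 0 → e.step ∈ Finset.range (K + 1) := fun e he _ =>
        Finset.mem_range.2 (Nat.lt_succ_of_le (step_le_of_consistent hcG e he))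
      have key := prod_factorial_mul_exp_neg_credits_le_rate hθ C (g K) G _ hT hP
      have hX : 0 ≤ Real.exp (lifeCost (dictW (R K) C.n₁) (cost C K (R K)) G) := (Real.exp_pos _).le
      have hΛp : 0 ≤ Λ' ^ partnerAges PEv.step G := pow_nonneg hΛ0 _
      calc (∏ t ∈ Finset.range (K + 1), (((birthsAt G.events t).card)! : ℝ)) *
            (Λ' ^ partnerAges PEv.step G * (Real.exp (-credits (credit C (g K)) G) *
              Real.exp (lifeCost (dictW (R K) C.n₁) (cost C K (R K)) G)))
          = Λ' ^ partnerAges PEv.step G *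
              ((∏ t ∈ Finset.range (K + 1), (((birthsAt G.events t).card)! : ℝ)) *
                Real.exp (-credits (credit C (g K)) G) *
                Real.exp (lifeCost (dictW (R K) C.n₁) (cost C K (R K)) G)) := by ring
        _ ≤ Λ' ^ partnerAges PEv.step G * (Real.exp (-credits (credit (lowerA C (rate θ)) (g K)) G) *
              Real.exp (lifeCost (dictW (R K) C.n₁) (cost C K (R K)) G)) :=
            mul_le_mul_of_nonneg_left (mul_le_mul_of_nonneg_right key hX) hΛp
  exact hx₀ R g β' h27 h29 hR hx1 hir hρbar hηbar hr hΛ0 hΛ1 y hy0 hlabM str hinj hstr hF hF'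

end EndToEnd

/-! ## §5 Sanity -/

namespace Sanity

/-- lowering by `1` then by `2` is lowering by `3` [folklore] -/
theorem lowerA_twice (C : T4PrintedShapeBanking.Consts) : lowerA (lowerA C 1) 2 = lowerA C 3 := by
  rw [lowerA_lowerA]; norm_num

/-- the profile floor on an instance: `A₀ = 1`, `p₀ = 3`, `log (x²)⁻¹ ≥ 1` [folklore] -/
theorem floor_example {x : ℝ} (hx : 1 ≤ Real.log (x ^ 2)⁻¹) : 1 ≤ p0Profile 1 3 x :=
  one_le_p0Profile le_rfl 3 hx

/-- the rate at `θ = 2` is `2 + log 2 < 3` (so `a > 3` has the room) [folklore] -/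
theorem rate_two_lt : rate 2 < 3 := by
  unfold rate
  have : Real.log (1 + 2 / 2) < 1 := by
    rw [show (1 : ℝ) + 2 / 2 = 2 by norm_num]
    have := Real.log_two_lt_d9
    linarith
  linarith

end Sanity

end

end Summit.QuantumFields.BalabanUV.T4Continuum.PartnerMultiplicityF
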